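import Summits.KontsevichZagierPeriods.KontsevichZagierPeriods.Theorems.RootDecompQuadraticDescentLegendrePairs

/-!
# The LEGENDRE AUTOPSY for `QuadraticDescent` (stmt-KontsevichZagierPeriods-26540) — part 3/3: translation scissors in dimension three, the graph regions `A_F`, `H_FG`, THE LEGENDRE TEST ELEMENT `xLeg c` with `legendre_improper` (Legendre is an IMPROPER `QuadraticDescent 3` input: ONE `Coinc(3)` pair), the named rung-3 test `LegendreByMoves` (`legendreByMoves_of_coinc3`, `legendreRelation_of_legendreByMoves`) and `legendre_specimen`

Theorems-split (≤ 400 lines each) of the decomp-kz lens-6 gen-4 file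
`run/shared/lean/pub/decomp-kz/decomp-kz-lens-6/g4/RootDecompQuadraticDescentLegendre.lean` (778 lines; critic CONFIRMED
2026-08-30T04:24:12Z: rc0 / 0 warn / std axioms, axioms(legendre_improper) = {propext, Classical.choice, Quot.sound}); parts
`…LegendreData` → `…LegendrePairs` → `…Legendre`. `LegendreRelation c` (K·E′ + E·K′ − K·K′ = π/2 for y² = t⁴ ± ct² + 1, |c| < 2)
is a PRINTED HYPOTHESIS, not proved here. Support (T5 evidence) for 26540; the named residue `LegendreByMoves` is an
instrument target of 26541 / 24769. Sources: Legendre 1825; Whittaker–Watson §22.736; Kontsevich–Zagier 2001 §1.2, §2.2.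
-/

noncomputable section

set_option linter.dupNamespace false

open MeasureTheory Set
open MvPolynomial (aeval X C)
open Literature.ModelTheory.ExponentialFields (IsSemialgebraic tarski_seidenberg_real_holds)

namespace Summit.KontsevichZagierPeriods.KontsevichZagierPeriods.Theorems.RootDecompQuadraticDescentLegendre

open Literature.NumberTheory.Transcendental
open Literature.NumberTheory.Transcendental.KZ

section LegendreAutopsy

variable {c : ℚ}

/-! ### Translation scissors in dimension three: merging two graph regions into ONE rational
representation (`KZ.exists_translate` + `KZ.IntegralRep.glue`) -/

/-- Two 3-dimensional representations with integrand the last coordinate, the first living over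
`{z₀ < 1}` and the second over `{0 < z₀}`, merge — after translating the second by `2` in the `z₀`
direction — into ONE KZ-rational representation `G` with `[G] − [U] − [V] ∈ KZ.relations`. -/
theorem exists_merge (U V : KZ.IntegralRep (1 + 1 + 1))
    (hUi : U.integrand = fun z => z (Fin.last 2)) (hVi : V.integrand = fun z => z (Fin.last 2))
    (hU : ∀ z ∈ U.domain, z 0 < 1) (hV : ∀ z ∈ V.domain, 0 < z 0) :
    ∃ G : KZ.IntegralRep (1 + 1 + 1), G.IsRational ∧ G.value = U.value + V.value ∧
      of G - of U - of V ∈ KZ.relations := by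
  set v : Fin (1 + 1 + 1) → ℚ := fun i => if i = 0 then 2 else 0 with hv
  obtain ⟨V', hd, hi, hrel⟩ := KZ.exists_translate V v
  have hl0 : (Fin.last 2 : Fin (1 + 1 + 1)) ≠ 0 := by decide
  have hw0 : (fun i => (v i : ℝ)) 0 = 2 := by simp [hv]
  have hwl : (fun i => (v i : ℝ)) (Fin.last 2) = 0 := by simp [hv]
  have hdisj : Disjoint U.domain V'.domain := by
    rw [Set.disjoint_left]
    intro z hzU hzV
    have h1 := hU z hzU
    rw [hd] at hzV
    have h2 := hV _ hzV
    simp only [Pi.sub_apply, hw0] at h2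
    linarith
  have hr : of (U.glue V' hdisj) - of U - of V ∈ KZ.relations := by
    have h := relations.sub_mem
      (domainAddRel_subset_relations (IntegralRep.of_glue_sub_sub_mem_domainAddRel U V' hdisj))
      (changeOfVariablesRel_subset_relations hrel)
    convert h using 1; abel
  have h0 := (AddMonoidHom.mem_ker).mp (KZ.relations_le_ker_eval_holds hr)
  simp only [map_sub, KZ.eval_of] at h0
  refine ⟨U.glue V' hdisj, ⟨X (Fin.last 2), 1, fun _ _ => by simp, fun z hz => ?_⟩, by linarith, hr⟩
  rcases hz with hz | hz
  · rw [IntegralRep.eqOn_integrand_glue_left _ _ _ hz, hUi]; simp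
  · rw [IntegralRep.eqOn_integrand_glue_right _ _ _ hz, hi, hVi]
    simp only [Pi.sub_apply, hwl, sub_zero, map_one, MvPolynomial.aeval_X, div_one]

/-! ### The graph regions `A_F` (dimension 2) and `H_FG` (dimension 3), and the lifted `π/2` -/

/-- Auxiliary step `nlo`. [bookkeeping] -/
lemma nlo (h : c < 2) : -2 < -c := by linarith
/-- Auxiliary step `nhi`. [bookkeeping] -/
lemma nhi (h : -2 < c) : -c < 2 := by linarith

/-- First coordinate of a point of the 3-dimensional graph region over `B × B'` with `B.domain = (0,1)`. -/
lemma coord0_graphRep_prod {B B' : KZ.IntegralRep 1} (hB : B.domain = I1) (z : Fin (1 + 1 + 1) → ℝ)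
    (hz : z ∈ ((B.prod B').graphRep tarski_seidenberg_real_holds).domain) : z 0 ∈ Set.Ioo (0:ℝ) 1 := by
  rw [IntegralRep.domain_graphRep] at hz
  have h1 : Fin.init z ∈ (B.prod B').domain := hz.1
  rw [IntegralRep.prod_domain, IntegralRep.mem_prodDomain, hB] at h1
  exact h1.1

/-- First coordinate of a point of the twice-lifted `Ph`. -/
lemma coord0_graphRep_graphRep (z : Fin (1 + 1 + 1) → ℝ)
    (hz : z ∈ ((Ph.graphRep tarski_seidenberg_real_holds).graphRep tarski_seidenberg_real_holds).domain) :
    z 0 ∈ Set.Ioo (0:ℝ) 1 := by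
  rw [IntegralRep.domain_graphRep] at hz
  have h1 : Fin.init z ∈ (Ph.graphRep tarski_seidenberg_real_holds).domain := hz.1
  rw [IntegralRep.domain_graphRep] at h1
  have h2 : Fin.init (Fin.init z) ∈ Ph.domain := h1.1
  exact h2

/-- `H B B' := graphRep (B × B')` has value `value B · value B'`. -/
lemma value_graphRep_prod (B B' : KZ.IntegralRep 1) :
    ((B.prod B').graphRep tarski_seidenberg_real_holds).value = B.value * B'.value := by
  rw [← KZ.Equivalent.value_eq_holds ((B.prod B').equivalent_graphRep tarski_seidenberg_real_holds),
    KZ.IntegralRep.value_prod]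

/-- `A × A' ∼ graphRep (B × B')` for `A = graphRep B`, `A' = graphRep B'` (three Newton–Leibniz moves
and the product congruence). -/
lemma graphRep_prod_graphRep_equivalent (B B' : KZ.IntegralRep 1) :
    Equivalent ((B.graphRep tarski_seidenberg_real_holds).prod (B'.graphRep tarski_seidenberg_real_holds))
      ((B.prod B').graphRep tarski_seidenberg_real_holds) :=
  (Equivalent.prod (B.equivalent_graphRep _).symm (B'.equivalent_graphRep _).symm).trans
    ((B.prod B').equivalent_graphRep _)

/-! ### THE LEGENDRE TEST ELEMENT and its descent -/

/-- THE LEGENDRE TEST ELEMENT (natively KZ-rational, quadratic, level `d = 3`):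
`xLeg c = [XK c]·[XE (-c)] + [XE c]·[XK (-c)] − [XK c]·[XK (-c)] − [W]·[Ph]`
(products of KZ-rational representations of dimensions `2+2`, `2+2`, `2+2`, `2+1 ≤ 3+1`;
value `π²·(K E' + E K' − K K') − π²·π/2`). -/
def xLeg (c : ℚ) (hc : -2 < c) (hc' : c < 2) : KZ.FormalRep :=
  of (XK c hc hc') * of (XE (-c) (nlo hc') (nhi hc)) + of (XE c hc hc') * of (XK (-c) (nlo hc') (nhi hc)) -
    of (XK c hc hc') * of (XK (-c) (nlo hc') (nhi hc)) - of W * of Ph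

/-- `xLeg c` is a generators-built input of `QuadraticDescent 3`. -/
theorem xLeg_mem_closure (hc : -2 < c) (hc' : c < 2) :
    xLeg c hc hc' ∈ AddSubgroup.closure
      ({y : KZ.FormalRep | ∃ (a b : ℕ) (s : KZ.IntegralRep a) (t : KZ.IntegralRep b),
          a ≤ 3 ∧ b ≤ 3 ∧ a + b ≤ 3 + 1 ∧ s.IsRational ∧ t.IsRational ∧ y = KZ.of s * KZ.of t} ∪
        {y : KZ.FormalRep | ∃ (k : ℕ) (u : KZ.IntegralRep k), k ≤ 3 ∧ u.IsRational ∧ y = KZ.of u}) := by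
  unfold xLeg
  refine AddSubgroup.sub_mem _ (AddSubgroup.sub_mem _ (AddSubgroup.add_mem _ ?_ ?_) ?_) ?_ <;>
    refine AddSubgroup.subset_closure (Set.mem_union_left _ ?_)
  · exact ⟨2, 2, _, _, by norm_num, by norm_num, by norm_num, isRational_XK hc hc',
      isRational_XE (nlo hc') (nhi hc), rfl⟩
  · exact ⟨2, 2, _, _, by norm_num, by norm_num, by norm_num, isRational_XE hc hc',
      isRational_XK (nlo hc') (nhi hc), rfl⟩
  · exact ⟨2, 2, _, _, by norm_num, by norm_num, by norm_num, isRational_XK hc hc',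
      isRational_XK (nlo hc') (nhi hc), rfl⟩
  · exact ⟨1 + 1, 1, _, _, by norm_num, by norm_num, by norm_num, isRational_W, isRational_Ph, rfl⟩

/-- `eval (xLeg c) = π² · (K E' + E K' − K K' − π/2)`; in particular `= 0` under Legendre's relation. -/
theorem eval_xLeg (hc : -2 < c) (hc' : c < 2) :
    KZ.eval (xLeg c hc hc') =
      Real.pi ^ 2 * (K c * E (-c) + E c * K (-c) - K c * K (-c) - Real.pi / 2) := by
  simp only [xLeg, map_sub, map_add, KZ.eval_mul', KZ.eval_of, value_XK, value_XE, value_W, value_Ph]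
  ring

/-- Auxiliary step `eval_xLeg_eq_zero`. [bookkeeping] -/
theorem eval_xLeg_eq_zero (hc : -2 < c) (hc' : c < 2) (hL : LegendreRelation c) :
    KZ.eval (xLeg c hc hc') = 0 := by
  rw [eval_xLeg, hL]; ring

/-- THE 3-DIMENSIONAL LINEAR SHADOW of Legendre's relation:
`Y c = [H(BK c, BE c')] + [H(BE c, BK c')] − [H(BK c, BK c')] − [Ph]`, `H(B,B') := graphRep (B × B')`
(KZ-rational of dimension `3`, value `value B · value B'`). -/
def yLeg (c : ℚ) (hc : -2 < c) (hc' : c < 2) : KZ.FormalRep :=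
  of (((BK c hc hc').prod (BE (-c) (nlo hc') (nhi hc))).graphRep tarski_seidenberg_real_holds) +
    of (((BE c hc hc').prod (BK (-c) (nlo hc') (nhi hc))).graphRep tarski_seidenberg_real_holds) -
    of (((BK c hc hc').prod (BK (-c) (nlo hc') (nhi hc))).graphRep tarski_seidenberg_real_holds) -
    of Ph

/-- SCISSORS + ONE COINCIDENCE: in any `R ⊇ KZ.relations` containing the differences of equal-valued
KZ-rational representations of dimensions `≤ 3`, Legendre's relation puts `Y c` in `R` — the four terms
merge pairwise (translation scissors, `exists_merge`) into two KZ-rational 3-dimensional representations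
of equal value. -/
theorem yLeg_mem (hc : -2 < c) (hc' : c < 2) (hL : LegendreRelation c)
    (R : AddSubgroup KZ.FormalRep) (hR : KZ.relations ≤ R)
    (hC : ∀ ⦃n m : ℕ⦄, n ≤ 3 → m ≤ 3 → ∀ (r : KZ.IntegralRep n) (r' : KZ.IntegralRep m),
      r.IsRational → r'.IsRational → r.value = r'.value → KZ.of r - KZ.of r' ∈ R) :
    yLeg c hc hc' ∈ R := by
  set H₁ := ((BK c hc hc').prod (BE (-c) (nlo hc') (nhi hc))).graphRep tarski_seidenberg_real_holds with hH₁
  set H₂ := ((BE c hc hc').prod (BK (-c) (nlo hc') (nhi hc))).graphRep tarski_seidenberg_real_holds with hH₂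
  set H₃ := ((BK c hc hc').prod (BK (-c) (nlo hc') (nhi hc))).graphRep tarski_seidenberg_real_holds with hH₃
  set L := (Ph.graphRep tarski_seidenberg_real_holds).graphRep tarski_seidenberg_real_holds with hL2
  obtain ⟨G₁₂, hG₁₂r, hG₁₂v, hG₁₂⟩ := exists_merge H₁ H₂ rfl rfl
    (fun z hz => (coord0_graphRep_prod (domain_BK hc hc') z hz).2)
    (fun z hz => (coord0_graphRep_prod (domain_BE hc hc') z hz).1)
  obtain ⟨G₃₄, hG₃₄r, hG₃₄v, hG₃₄⟩ := exists_merge H₃ L rfl rfl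
    (fun z hz => (coord0_graphRep_prod (domain_BK hc hc') z hz).2)
    (fun z hz => (coord0_graphRep_graphRep z hz).1)
  have hLv : L.value = Real.pi / 2 := by
    rw [hL2, ← KZ.Equivalent.value_eq_holds ((Ph.graphRep tarski_seidenberg_real_holds).equivalent_graphRep _),
      ← KZ.Equivalent.value_eq_holds (Ph.equivalent_graphRep _), value_Ph]
  have hv : G₁₂.value = G₃₄.value := by
    rw [hG₁₂v, hG₃₄v, hH₁, hH₂, hH₃, value_graphRep_prod, value_graphRep_prod, value_graphRep_prod, hLv]
    simp only [value_BK, value_BE]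
    have hL' := hL
    unfold LegendreRelation at hL'
    linarith
  have c1234 : of G₁₂ - of G₃₄ ∈ R := hC (by norm_num) (by norm_num) G₁₂ G₃₄ hG₁₂r hG₃₄r hv
  have rL : of Ph - of L ∈ KZ.relations :=
    (Ph.equivalent_graphRep _).trans ((Ph.graphRep tarski_seidenberg_real_holds).equivalent_graphRep _)
  have h := R.sub_mem (R.add_mem (R.sub_mem c1234 (hR hG₁₂)) (hR hG₃₄)) (hR rL)
  unfold yLeg
  convert h using 1
  abel

/-- THE FACTORISATION PAIRS: `[X_F] − [P × A_F] ∈ R` for `F = K, E` (dimensions `2` and `3`, both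
KZ-rational, equal values `π · F` by Fubini) — instances of the coincidence hypothesis `hC(3)`. -/
lemma pair_XK (hc : -2 < c) (hc' : c < 2) (R : AddSubgroup KZ.FormalRep)
    (hC : ∀ ⦃n m : ℕ⦄, n ≤ 3 → m ≤ 3 → ∀ (r : KZ.IntegralRep n) (r' : KZ.IntegralRep m),
      r.IsRational → r'.IsRational → r.value = r'.value → KZ.of r - KZ.of r' ∈ R) :
    of (XK c hc hc') - of (P.prod ((BK c hc hc').graphRep tarski_seidenberg_real_holds)) ∈ R := by
  refine hC (by norm_num) (by norm_num) _ _ (isRational_XK hc hc')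
    (isRational_prod isRational_P (KZ.IntegralRep.isRational_graphRep _ _)) ?_
  rw [value_XK, KZ.IntegralRep.value_prod, value_P,
    ← KZ.Equivalent.value_eq_holds ((BK c hc hc').equivalent_graphRep _), value_BK]

/-- Auxiliary step `pair_XE`. [bookkeeping] -/
lemma pair_XE (hc : -2 < c) (hc' : c < 2) (R : AddSubgroup KZ.FormalRep)
    (hC : ∀ ⦃n m : ℕ⦄, n ≤ 3 → m ≤ 3 → ∀ (r : KZ.IntegralRep n) (r' : KZ.IntegralRep m),
      r.IsRational → r'.IsRational → r.value = r'.value → KZ.of r - KZ.of r' ∈ R) :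
    of (XE c hc hc') - of (P.prod ((BE c hc hc').graphRep tarski_seidenberg_real_holds)) ∈ R := by
  refine hC (by norm_num) (by norm_num) _ _ (isRational_XE hc hc')
    (isRational_prod isRational_P (KZ.IntegralRep.isRational_graphRep _ _)) ?_
  rw [value_XE, KZ.IntegralRep.value_prod, value_P,
    ← KZ.Equivalent.value_eq_holds ((BE c hc hc').equivalent_graphRep _), value_BE]

/-- **`xLeg ≡ [W]·Y mod R`**: the quadratic Legendre element reduces, modulo the coincidence pairs of
dimension `≤ 3` and the ideal property, to `[W]` times its 3-dimensional LINEAR shadow. -/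
theorem xLeg_sub_W_mul_yLeg_mem (hc : -2 < c) (hc' : c < 2)
    (R : AddSubgroup KZ.FormalRep) (hR : KZ.relations ≤ R)
    (hI : ∀ c ∈ R, ∀ y : KZ.FormalRep, c * y ∈ R ∧ y * c ∈ R)
    (hC : ∀ ⦃n m : ℕ⦄, n ≤ 3 → m ≤ 3 → ∀ (r : KZ.IntegralRep n) (r' : KZ.IntegralRep m),
      r.IsRational → r'.IsRational → r.value = r'.value → KZ.of r - KZ.of r' ∈ R) :
    xLeg c hc hc' - of W * yLeg c hc hc' ∈ R := by
  have t1 := prod_step hR hI (pair_XK hc hc' R hC) (pair_XE (nlo hc') (nhi hc) R hC)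
    (graphRep_prod_graphRep_equivalent (BK c hc hc') (BE (-c) (nlo hc') (nhi hc)))
  have t2 := prod_step hR hI (pair_XE hc hc' R hC) (pair_XK (nlo hc') (nhi hc) R hC)
    (graphRep_prod_graphRep_equivalent (BE c hc hc') (BK (-c) (nlo hc') (nhi hc)))
  have t3 := prod_step hR hI (pair_XK hc hc' R hC) (pair_XK (nlo hc') (nhi hc) R hC)
    (graphRep_prod_graphRep_equivalent (BK c hc hc') (BK (-c) (nlo hc') (nhi hc)))
  have h := R.sub_mem (R.add_mem t1 t2) t3
  unfold xLeg yLeg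
  convert h using 1
  simp only [mul_add, mul_sub]
  abel

/-- **THE LEGENDRE ELEMENT IS AN IMPROPER INPUT OF `QuadraticDescent 3`**: in EVERY `R ⊇ KZ.relations`
that is a two-sided ideal and contains the coincidences of KZ-rational representations of dimensions
`≤ 3` (the three hypotheses of `QuadraticDescent 3` — NO appeal to `QuadraticDescent`), Legendre's
relation puts `xLeg c` in `R`.  Its descent is decided at rung 3 (`yLeg_mem`), not by the quadratic
piece. -/
theorem legendre_improper (hc : -2 < c) (hc' : c < 2) (hL : LegendreRelation c)
    (R : AddSubgroup KZ.FormalRep) (hR : KZ.relations ≤ R)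
    (hI : ∀ c ∈ R, ∀ y : KZ.FormalRep, c * y ∈ R ∧ y * c ∈ R)
    (hC : ∀ ⦃n m : ℕ⦄, n ≤ 3 → m ≤ 3 → ∀ (r : KZ.IntegralRep n) (r' : KZ.IntegralRep m),
      r.IsRational → r'.IsRational → r.value = r'.value → KZ.of r - KZ.of r' ∈ R) :
    xLeg c hc hc' ∈ R := by
  have h1 := xLeg_sub_W_mul_yLeg_mem hc hc' R hR hI hC
  have h2 : of W * yLeg c hc hc' ∈ R := (hI _ (yLeg_mem hc hc' hL R hR hC) (of W)).2
  have h := R.add_mem h1 h2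
  convert h using 1
  abel

/-! ### The named rung-3 test: LEGENDRE BY MOVES -/

/-- `eval (yLeg c) = K E' + E K' − K K' − π/2`. -/
theorem eval_yLeg (hc : -2 < c) (hc' : c < 2) :
    KZ.eval (yLeg c hc hc') = K c * E (-c) + E c * K (-c) - K c * K (-c) - Real.pi / 2 := by
  simp only [yLeg, map_sub, map_add, KZ.eval_of, value_graphRep_prod, value_BK, value_BE, value_Ph]

/-- NAMED TEST for the rung-3 stratum (`DescentThreeQ` stmt-KontsevichZagierPeriods-26541 /
`DescentThree` stmt-24769 / `KZ_leRat 3`): **Legendre's relation realised by the moves** — the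
four-term combination `yLeg c` of three KZ-rational SOLIDS (graph regions of dimension `3` over products of
elliptic arcs, values `K E'`, `E K'`, `K K'`) and the arc `[(0,1), 2/(1+u²)]` lies in `KZ.relations`. -/
def LegendreByMoves (c : ℚ) (hc : -2 < c) (hc' : c < 2) : Prop := yLeg c hc hc' ∈ KZ.relations

/-- Soundness direction: `LegendreByMoves c` IMPLIES Legendre's relation (so the test is exactly as strong
as the printed identity, in move form). -/
theorem legendreRelation_of_legendreByMoves (hc : -2 < c) (hc' : c < 2) (h : LegendreByMoves c hc hc') :
    LegendreRelation c := by
  have h0 := (AddMonoidHom.mem_ker).mp (KZ.relations_le_ker_eval_holds h)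
  rw [eval_yLeg] at h0
  unfold LegendreRelation
  linarith

/-- The rung-3 coincidence statement (pairs of equal-valued KZ-rational representations of dimensions
`≤ 3` are move-equivalent — `KZ_leRat 3` in pair form, the conclusion of `DescentThreeQ` at
`R = KZ.relations`) together with Legendre's relation GIVES `LegendreByMoves c`: the test is an instance
of the rung-3 stratum, outside every proved regime (the two merged solids have values `K E' + E K'` and
`K K' + π/2`, products of elliptic periods). -/
theorem legendreByMoves_of_coinc3 (hc : -2 < c) (hc' : c < 2) (hL : LegendreRelation c)
    (coinc3 : ∀ ⦃n m : ℕ⦄, n ≤ 3 → m ≤ 3 → ∀ (r : KZ.IntegralRep n) (r' : KZ.IntegralRep m),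
      r.IsRational → r'.IsRational → r.value = r'.value → KZ.Equivalent r r') :
    LegendreByMoves c hc hc' :=
  yLeg_mem hc hc' hL KZ.relations le_rfl coinc3

/-- SPECIMEN `c = 1` (`Q = t⁴ + t² + 1`, `Q' = t⁴ − t² + 1`): the Legendre test element is a value-zero
generators-built input of `QuadraticDescent 3` (under Legendre's relation) lying in every admissible `R`
with `Coinc(R,3)` — no appeal to `QuadraticDescent`. -/
theorem legendre_specimen (hL : LegendreRelation 1) (R : AddSubgroup KZ.FormalRep) (hR : KZ.relations ≤ R)
    (hI : ∀ c ∈ R, ∀ y : KZ.FormalRep, c * y ∈ R ∧ y * c ∈ R)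
    (hC : ∀ ⦃n m : ℕ⦄, n ≤ 3 → m ≤ 3 → ∀ (r : KZ.IntegralRep n) (r' : KZ.IntegralRep m),
      r.IsRational → r'.IsRational → r.value = r'.value → KZ.of r - KZ.of r' ∈ R) :
    KZ.eval (xLeg 1 (by norm_num) (by norm_num)) = 0 ∧ xLeg 1 (by norm_num) (by norm_num) ∈ R :=
  ⟨eval_xLeg_eq_zero _ _ hL, legendre_improper _ _ hL R hR hI hC⟩

end LegendreAutopsy

end Summit.KontsevichZagierPeriods.KontsevichZagierPeriods.Theorems.RootDecompQuadraticDescentLegendre
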